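import Summits.CriticalPhenomena.Ising3DConformalLimit.Theorems.RotationUpgradeFromTwoPoint.Negative.CubicDecoyNegatives
import Mathlib.Analysis.Real.Pi.Irrational
import Mathlib.Analysis.SpecialFunctions.Trigonometric.Complex
import Mathlib.Analysis.SpecialFunctions.Trigonometric.Inverse

/-!
# `RotationUpgradeFromTwoPoint` (item stmt-CriticalPhenomena-8367): tightness of the registered stub `stub_circleClosed` of line `two-crystals-generate-so3`

Standing crux disprover (D-0016), cycle 2. The lead's skeleton (sha `589b0f0d500a`, line
`two-crystals-generate-so3`, 7 registered stubs) closes the crux through the "closed circle" stub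

  `stub_circleClosed`: a family `S` continuous on `NonCoincident`, zero off it, invariant under ONE
  member `T θ₀` of a continuous one-parameter group `T : ℝ → O(3)` with `T (2π) = 1` and
  `θ₀ / 2π` irrational, is invariant under EVERY `T φ`.

The stub is TRUE (a closed subgroup of `ℝ` containing `θ₀` and `2π` is `ℝ`). This file shows that two
of its hypotheses are LOAD-BEARING, with explicit witnesses (so no weakening of the stub survives):

* `stubCircleClosed_false_without_irrational`: drop the irrationality clause ⇒ false. Witness: the
  rotations `Rz φ` about the third axis, `θ₀ = π/2` (a lattice rotation) and the cubic decoy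
  `cubicFamily 1` (continuous off the diagonals, normalised, `B₃` invariant, hence `Rz (π/2)`
  invariant), which is not invariant under the rational rotation `Rz (arccos (3/5))`: on the
  collinear quadruple `0, e₀, 2e₀, 3e₀` that rotation agrees with the reflection `R₀` of
  `Negative/CubicDecoyNegatives.lean`.
* `stubCircleClosed_false_without_continuity`: drop continuity of `S` on `NonCoincident` ⇒ false.
  Witness: `Rz`, `θ₀ = 1` radian (`1/2π` irrational by `irrational_pi`) and the indicator (at order
  one) of the orbit `{Rz k e₀ | k ∈ ℤ}`: invariant under `Rz 1`, not under `Rz (π/2)` (`e₁` is not on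
  the orbit: `sin k = 1` would make `π` rational).

All statements are model-blind and inlined (no `def : Prop`); `Rz` is built here as a
`LinearIsometryEquiv` family with its group law, so provers of the stub may import `Rz`, `Rz_add`,
`Rz_two_pi`, `continuous_Rz`.
-/

noncomputable section

namespace Summit.CriticalPhenomena.Ising3DConformalLimit.RotationUpgradeFromTwoPointNegative

open Literature.Probability.LatticeModels Literature.Barriers.CriticalPhenomena
open Filter Set Function ScaleNotMoebius
open scoped Topology Real

/-! ## The rotations about the third coordinate axis -/

/-- Rotation by `φ` about the `x₂`-axis, as a linear map of `ℝ³`. [folklore] -/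
def rzLin (φ : ℝ) : EuclideanSpace ℝ (Fin 3) →ₗ[ℝ] EuclideanSpace ℝ (Fin 3) where
  toFun x := WithLp.toLp 2
    ![Real.cos φ * x 0 - Real.sin φ * x 1, Real.sin φ * x 0 + Real.cos φ * x 1, x 2]
  map_add' x y := by
    ext j
    fin_cases j <;> simp <;> ring
  map_smul' c x := by
    ext j
    fin_cases j <;> simp <;> ring

/-- Unfolding of `rzLin`. [folklore] -/
theorem rzLin_apply (φ : ℝ) (x : EuclideanSpace ℝ (Fin 3)) :
    rzLin φ x = WithLp.toLp 2
      ![Real.cos φ * x 0 - Real.sin φ * x 1, Real.sin φ * x 0 + Real.cos φ * x 1, x 2] := rfl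

/-- `rzLin φ` preserves the Euclidean norm. [folklore] -/
theorem norm_rzLin (φ : ℝ) (x : EuclideanSpace ℝ (Fin 3)) : ‖rzLin φ x‖ = ‖x‖ := by
  rw [EuclideanSpace.norm_eq, EuclideanSpace.norm_eq]
  congr 1
  simp only [Fin.sum_univ_three, rzLin_apply, Real.norm_eq_abs, sq_abs, PiLp.toLp_apply,
    Matrix.cons_val_zero, Matrix.cons_val_one, Matrix.cons_val]
  linear_combination (x 0 ^ 2 + x 1 ^ 2) * Real.sin_sq_add_cos_sq φ

/-- Rotation by `φ` about the `x₂`-axis, as a linear isometry. [folklore] -/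
def rzIso (φ : ℝ) : EuclideanSpace ℝ (Fin 3) →ₗᵢ[ℝ] EuclideanSpace ℝ (Fin 3) :=
  ⟨rzLin φ, norm_rzLin φ⟩

/-- **`Rz φ`**: rotation by `φ` about the `x₂`-axis, as a linear isometry equivalence — the
one-parameter group `T` of the stub. [folklore] -/
def Rz (φ : ℝ) : EuclideanSpace ℝ (Fin 3) ≃ₗᵢ[ℝ] EuclideanSpace ℝ (Fin 3) :=
  (rzIso φ).toLinearIsometryEquiv rfl

/-- Unfolding of `Rz`. [folklore] -/
theorem Rz_apply (φ : ℝ) (x : EuclideanSpace ℝ (Fin 3)) :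
    Rz φ x = WithLp.toLp 2
      ![Real.cos φ * x 0 - Real.sin φ * x 1, Real.sin φ * x 0 + Real.cos φ * x 1, x 2] := rfl

/-- Coordinate `0` of `Rz φ x`. [folklore] -/
@[simp] theorem Rz_apply_zero (φ : ℝ) (x : EuclideanSpace ℝ (Fin 3)) :
    Rz φ x 0 = Real.cos φ * x 0 - Real.sin φ * x 1 := by
  simp [Rz_apply]

/-- Coordinate `1` of `Rz φ x`. [folklore] -/
@[simp] theorem Rz_apply_one (φ : ℝ) (x : EuclideanSpace ℝ (Fin 3)) :
    Rz φ x 1 = Real.sin φ * x 0 + Real.cos φ * x 1 := by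
  simp [Rz_apply]

/-- Coordinate `2` of `Rz φ x`. [folklore] -/
@[simp] theorem Rz_apply_two (φ : ℝ) (x : EuclideanSpace ℝ (Fin 3)) : Rz φ x 2 = x 2 := by
  simp [Rz_apply]

/-- Group law: `Rz (φ + ψ) = Rz φ ∘ Rz ψ`. [folklore] -/
theorem Rz_add (φ ψ : ℝ) (x : EuclideanSpace ℝ (Fin 3)) : Rz (φ + ψ) x = Rz φ (Rz ψ x) := by
  ext j
  fin_cases j
  · simp [Real.cos_add, Real.sin_add]
    ring
  · simp [Real.cos_add, Real.sin_add]
    ring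
  · simp

/-- `Rz 0 = 1`. [folklore] -/
theorem Rz_zero (x : EuclideanSpace ℝ (Fin 3)) : Rz 0 x = x := by
  ext j
  fin_cases j <;> simp

/-- `Rz (2π) = 1`. [folklore] -/
theorem Rz_two_pi (x : EuclideanSpace ℝ (Fin 3)) : Rz (2 * Real.pi) x = x := by
  ext j
  fin_cases j <;> simp

/-- `Rz (-φ)` undoes `Rz φ`. [folklore] -/
theorem Rz_neg_apply (φ : ℝ) (x : EuclideanSpace ℝ (Fin 3)) : Rz (-φ) (Rz φ x) = x := by
  rw [← Rz_add, neg_add_cancel, Rz_zero]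

/-- The orbit maps `φ ↦ Rz φ x` are continuous. [folklore] -/
theorem continuous_Rz (x : EuclideanSpace ℝ (Fin 3)) : Continuous fun φ => Rz φ x := by
  simp only [Rz_apply]
  refine (PiLp.continuous_toLp 2 _).comp (continuous_pi fun j => ?_)
  fin_cases j
  · simp only [Fin.zero_eta, Matrix.cons_val_zero]
    exact (Real.continuous_cos.mul continuous_const).sub (Real.continuous_sin.mul continuous_const)
  · simp only [Fin.mk_one, Matrix.cons_val_one, Matrix.cons_val_zero]
    exact (Real.continuous_sin.mul continuous_const).add (Real.continuous_cos.mul continuous_const)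
  · exact continuous_const

/-- The quarter turn `Rz (π/2) (a, b, c) = (-b, a, c)` — a lattice rotation (element of `B₃`).
[folklore] -/
theorem Rz_pi_div_two (x : EuclideanSpace ℝ (Fin 3)) :
    Rz (Real.pi / 2) x = WithLp.toLp 2 ![-x 1, x 0, x 2] := by
  ext j
  fin_cases j <;> simp

/-- `sin (arccos (3/5)) = 4/5`. [folklore] -/
theorem sin_arccos_three_fifths : Real.sin (Real.arccos (3 / 5)) = 4 / 5 := by
  rw [Real.sin_arccos]
  have h : (1:ℝ) - (3 / 5) ^ 2 = (4 / 5) ^ 2 := by norm_num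
  rw [h, Real.sqrt_sq (by norm_num)]

/-- `cos (arccos (3/5)) = 3/5`. [folklore] -/
theorem cos_arccos_three_fifths : Real.cos (Real.arccos (3 / 5)) = 3 / 5 :=
  Real.cos_arccos (by norm_num) (by norm_num)

/-- The RATIONAL rotation `Rz (arccos (3/5))` maps `t e₀` to `t u`, `u = (3/5, 4/5, 0)`: on the
axis it agrees with the reflection `R₀` of the decoy negatives. [folklore] -/
theorem Rz_arccos_axisPt (t : ℝ) : Rz (Real.arccos (3 / 5)) (axisPt t) = t • uDir := by
  ext j
  fin_cases j <;>
    simp [axisPt, axisUnit, uDir, sin_arccos_three_fifths, cos_arccos_three_fifths]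

/-- Hence `Rz (arccos (3/5))` and `R₀` agree on the collinear test quadruple `configU4`.
[folklore] -/
theorem Rz_arccos_configU4 :
    (fun i => Rz (Real.arccos (3 / 5)) (configU4 i)) = fun i => R₀ (configU4 i) := by
  rw [R₀_configU4]
  funext i
  fin_cases i <;> simp [configU4, Rz_arccos_axisPt]

/-! ## The cubic decoy is invariant under the quarter turn -/

/-- The sign pattern `(1, -1, 1)`. [folklore] -/
def epsFlip1 : Fin 3 → ℤˣ := ![1, -1, 1]

/-- `Rz (π/2) = P_swap ∘ R_ε` with `P_swap` the coordinate swap `0 ↔ 1` and `R_ε` the sign flip of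
coordinate `1`; here `R_ε := P_swap⁻¹ ∘ Rz (π/2)` satisfies the sign-flip equations. [folklore] -/
theorem swap_symm_Rz_pi_div_two_apply (p : EuclideanSpace ℝ (Fin 3)) (j : Fin 3) :
    ((Rz (Real.pi / 2)).trans
        (LinearIsometryEquiv.piLpCongrLeft 2 ℝ ℝ (Equiv.swap (0 : Fin 3) 1)).symm) p j =
      ((epsFlip1 j : ℤ) : ℝ) * p j := by
  rw [LinearIsometryEquiv.trans_apply, LinearIsometryEquiv.piLpCongrLeft_symm, coordPerm_apply_loc]
  fin_cases j
  · simp [epsFlip1, Equiv.swap_apply_def]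
  · simp [epsFlip1, Equiv.swap_apply_def]
  · have h2 : (Equiv.swap (0 : Fin 3) 1) 2 = 2 := by decide
    simp [epsFlip1, h2]

/-- **The cubic decoy is invariant under the quarter turn `Rz (π/2)`** (it is `B₃` invariant:
`cubicFamily_coordPerm`, `cubicFamily_signFlip`). [folklore] -/
theorem cubicFamily_Rz_pi_div_two (Δ : ℝ) (n : ℕ) (x : Fin n → EuclideanSpace ℝ (Fin 3)) :
    cubicFamily Δ n (fun i => Rz (Real.pi / 2) (x i)) = cubicFamily Δ n x := by
  set P := LinearIsometryEquiv.piLpCongrLeft 2 ℝ ℝ (Equiv.swap (0 : Fin 3) 1) with hP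
  set Rε := (Rz (Real.pi / 2)).trans P.symm with hRε
  have hcfg : (fun i => Rz (Real.pi / 2) (x i)) = fun i => P (Rε (x i)) := by
    funext i
    simp [hRε]
  rw [hcfg, cubicFamily_coordPerm Δ _ n (fun i => Rε (x i))]
  exact cubicFamily_signFlip Δ epsFlip1 Rε (fun p j => swap_symm_Rz_pi_div_two_apply p j) n x

/-! ## The registered stub `stub_circleClosed` and its two load-bearing clauses

Registered stub of the lead's skeleton `589b0f0d500a` (VERBATIM, for reference; TRUE, not attacked):

  ∀ (S : CorrFamily 3) (T : ℝ → (E³ ≃ₗᵢ[ℝ] E³)) (θ₀ : ℝ), (∀ n, ContinuousOn (S n) (NonCoincident 3 n)) →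
    (∀ n z, z ∉ NonCoincident 3 n → S n z = 0) → (∀ φ ψ x, T (φ + ψ) x = T φ (T ψ x)) →
    (∀ x, Continuous fun φ => T φ x) → (∀ x, T (2 * Real.pi) x = x) →
    (∀ m k : ℤ, m ≠ 0 → (m : ℝ) * θ₀ ≠ (k : ℝ) * (2 * Real.pi)) →
    (∀ (n : ℕ) (x : Fin n → E³), S n (fun i => T θ₀ (x i)) = S n x) →
    ∀ (φ : ℝ) (n : ℕ) (x : Fin n → E³), S n (fun i => T φ (x i)) = S n x

The two theorems below negate it with ONE clause deleted each (statements inlined, no `def : Prop`).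
-/

/-- **The irrationality clause of `stub_circleClosed` is load-bearing.** Witness: `T = Rz`,
`θ₀ = π/2`, `S = cubicFamily 1` (continuous off the diagonals, normalised, invariant under the
lattice rotation `Rz (π/2)`), and the rational rotation `Rz (arccos (3/5))`, which moves the
collinear quadruple `configU4` exactly as the reflection `R₀` does — and `S₄` of the decoy is not
`R₀` invariant (`cubicFamily_four_R₀_ne`). [folklore] -/
theorem stubCircleClosed_false_without_irrational :
    ¬ ∀ (S : CorrFamily 3) (T : ℝ → (EuclideanSpace ℝ (Fin 3) ≃ₗᵢ[ℝ] EuclideanSpace ℝ (Fin 3)))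
        (θ₀ : ℝ),
      (∀ n, ContinuousOn (S n) (NonCoincident 3 n)) →
      (∀ n z, z ∉ NonCoincident 3 n → S n z = 0) →
      (∀ φ ψ x, T (φ + ψ) x = T φ (T ψ x)) → (∀ x, Continuous fun φ => T φ x) →
      (∀ x, T (2 * Real.pi) x = x) →
      (∀ (n : ℕ) (x : Fin n → EuclideanSpace ℝ (Fin 3)), S n (fun i => T θ₀ (x i)) = S n x) →
      ∀ (φ : ℝ) (n : ℕ) (x : Fin n → EuclideanSpace ℝ (Fin 3)),
        S n (fun i => T φ (x i)) = S n x := by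
  intro h
  have key := h (cubicFamily 1) Rz (Real.pi / 2) (continuousOn_cubicFamily 1)
    (cubicFamily_eq_zero_of_not_mem one_ne_zero) Rz_add continuous_Rz Rz_two_pi
    (cubicFamily_Rz_pi_div_two 1) (Real.arccos (3 / 5)) 4 configU4
  rw [Rz_arccos_configU4] at key
  exact cubicFamily_four_R₀_ne 1 key

/-! ### The orbit witness for the continuity clause -/

/-- The orbit `{Rz k e₀ | k ∈ ℤ}` of the axis unit vector under the integer powers of the rotation
by one radian. [folklore] -/
def unitOrbit : Set (EuclideanSpace ℝ (Fin 3)) := Set.range fun k : ℤ => Rz (k : ℝ) axisUnit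

open Classical in
/-- The orbit indicator at order one (all other orders zero): a normalised, `Rz 1`-invariant
family that is NOT invariant under the whole circle group. [folklore] -/
def orbitFamily : CorrFamily 3 := fun n =>
  match n with
  | 1 => fun x => if x 0 ∈ unitOrbit then 1 else 0
  | _ => fun _ => 0

/-- The orbit is stable under `Rz 1` in both directions. [folklore] -/
theorem Rz_one_mem_unitOrbit_iff (y : EuclideanSpace ℝ (Fin 3)) :
    Rz 1 y ∈ unitOrbit ↔ y ∈ unitOrbit := by
  constructor
  · rintro ⟨k, hk⟩
    have hk' : Rz (k : ℝ) axisUnit = Rz 1 y := hk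
    refine ⟨k - 1, ?_⟩
    show Rz ((k - 1 : ℤ) : ℝ) axisUnit = y
    have hcast : ((k - 1 : ℤ) : ℝ) = -1 + (k : ℝ) := by push_cast; ring
    rw [hcast, Rz_add, hk', Rz_neg_apply]
  · rintro ⟨k, hk⟩
    have hk' : Rz (k : ℝ) axisUnit = y := hk
    refine ⟨k + 1, ?_⟩
    show Rz ((k + 1 : ℤ) : ℝ) axisUnit = Rz 1 y
    have hcast : ((k + 1 : ℤ) : ℝ) = 1 + (k : ℝ) := by push_cast; ring
    rw [hcast, Rz_add, hk']

/-- `θ₀ = 1` radian is an irrational angle: `m ≠ 2πk` for `m ≠ 0` (irrationality of `π`).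
[folklore] -/
theorem one_radian_irrational (m k : ℤ) (hm : m ≠ 0) : (m : ℝ) * 1 ≠ (k : ℝ) * (2 * Real.pi) := by
  intro h
  rw [mul_one] at h
  by_cases hk : k = 0
  · rw [hk, Int.cast_zero, zero_mul] at h
    exact hm (by exact_mod_cast h)
  · have hk2 : ((2 * k : ℤ) : ℝ) ≠ 0 := by
      push_cast
      exact mul_ne_zero two_ne_zero (Int.cast_ne_zero.mpr hk)
    have hpi : Real.pi = (m : ℝ) / ((2 * k : ℤ) : ℝ) := by
      rw [eq_div_iff hk2, h]
      push_cast
      ring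
    exact irrational_pi.ne_rational m (2 * k) hpi

/-- `e₀` lies on the orbit (`k = 0`). [folklore] -/
theorem axisUnit_mem_unitOrbit : axisUnit ∈ unitOrbit := by
  refine ⟨0, ?_⟩
  show Rz ((0 : ℤ) : ℝ) axisUnit = axisUnit
  rw [Int.cast_zero, Rz_zero]

/-- `Rz (π/2) e₀ = e₁` does NOT lie on the orbit: `sin k = 1` for an integer `k` would make `π`
rational. [folklore] -/
theorem Rz_pi_div_two_axisUnit_not_mem : Rz (Real.pi / 2) axisUnit ∉ unitOrbit := by
  rintro ⟨k, hk⟩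
  have hk' : Rz (k : ℝ) axisUnit = Rz (Real.pi / 2) axisUnit := hk
  have h1 : Rz (k : ℝ) axisUnit 1 = Rz (Real.pi / 2) axisUnit 1 := by rw [hk']
  simp [axisUnit] at h1
  -- `h1 : sin k = 1`
  obtain ⟨m, hm⟩ := Real.sin_eq_one_iff.1 h1
  have hk0 : k ≠ 0 := by
    rintro rfl
    simp at h1
  have key : ((4 * k : ℤ) : ℝ) * 1 = ((1 + 4 * m : ℤ) : ℝ) * (2 * Real.pi) := by
    push_cast
    rw [← hm]
    ring
  exact one_radian_irrational (4 * k) (1 + 4 * m) (by omega) key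

/-- Every configuration of ONE point is non-coincident. [folklore] -/
theorem mem_nonCoincident_one (z : Fin 1 → EuclideanSpace ℝ (Fin 3)) : z ∈ NonCoincident 3 1 := by
  rw [mem_nonCoincident]
  exact Function.injective_of_subsingleton z

/-- The orbit family is normalised (zero off `NonCoincident`). [folklore] -/
theorem orbitFamily_norm (n : ℕ) (z : Fin n → EuclideanSpace ℝ (Fin 3))
    (hz : z ∉ NonCoincident 3 n) : orbitFamily n z = 0 := by
  match n, z, hz with
  | 0, _, _ => rfl
  | 1, z, hz => exact absurd (mem_nonCoincident_one z) hz
  | (n + 2), _, _ => rfl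

open Classical in
/-- The orbit family is invariant under `Rz 1`. [folklore] -/
theorem orbitFamily_Rz_one (n : ℕ) (x : Fin n → EuclideanSpace ℝ (Fin 3)) :
    orbitFamily n (fun i => Rz 1 (x i)) = orbitFamily n x := by
  match n, x with
  | 0, _ => rfl
  | 1, x =>
    show (if Rz 1 (x 0) ∈ unitOrbit then (1:ℝ) else 0) = if x 0 ∈ unitOrbit then 1 else 0
    rw [Rz_one_mem_unitOrbit_iff]
  | (n + 2), _ => rfl

open Classical in
/-- … but NOT under `Rz (π/2)`: order one, the single point `e₀`. [folklore] -/
theorem orbitFamily_Rz_pi_div_two_ne :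
    orbitFamily 1 (fun i => Rz (Real.pi / 2) ((![axisUnit] : Fin 1 → EuclideanSpace ℝ (Fin 3)) i)) ≠
      orbitFamily 1 ![axisUnit] := by
  show (if Rz (Real.pi / 2) ((![axisUnit] : Fin 1 → EuclideanSpace ℝ (Fin 3)) 0) ∈ unitOrbit
      then (1:ℝ) else 0) ≠
    if (![axisUnit] : Fin 1 → EuclideanSpace ℝ (Fin 3)) 0 ∈ unitOrbit then 1 else 0
  simp only [Matrix.cons_val_fin_one]
  rw [if_neg Rz_pi_div_two_axisUnit_not_mem, if_pos axisUnit_mem_unitOrbit]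
  norm_num

/-- **Continuity of `S` in `stub_circleClosed` is load-bearing.** Witness: `T = Rz`, `θ₀ = 1`
radian, `S = orbitFamily` (normalised, `Rz 1` invariant, discontinuous at order one), moved by
`Rz (π/2)`. For the crux this costs nothing — continuity of every limit of `criticalCorr 3` is
free (`Negative/ContinuityFree.lean`) — but the stub cannot be weakened. [folklore] -/
theorem stubCircleClosed_false_without_continuity :
    ¬ ∀ (S : CorrFamily 3) (T : ℝ → (EuclideanSpace ℝ (Fin 3) ≃ₗᵢ[ℝ] EuclideanSpace ℝ (Fin 3)))
        (θ₀ : ℝ),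
      (∀ n z, z ∉ NonCoincident 3 n → S n z = 0) →
      (∀ φ ψ x, T (φ + ψ) x = T φ (T ψ x)) → (∀ x, Continuous fun φ => T φ x) →
      (∀ x, T (2 * Real.pi) x = x) →
      (∀ m k : ℤ, m ≠ 0 → (m : ℝ) * θ₀ ≠ (k : ℝ) * (2 * Real.pi)) →
      (∀ (n : ℕ) (x : Fin n → EuclideanSpace ℝ (Fin 3)), S n (fun i => T θ₀ (x i)) = S n x) →
      ∀ (φ : ℝ) (n : ℕ) (x : Fin n → EuclideanSpace ℝ (Fin 3)),
        S n (fun i => T φ (x i)) = S n x := by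
  intro h
  exact orbitFamily_Rz_pi_div_two_ne (h orbitFamily Rz 1 orbitFamily_norm Rz_add continuous_Rz
    Rz_two_pi one_radian_irrational orbitFamily_Rz_one (Real.pi / 2) 1 ![axisUnit])

end Summit.CriticalPhenomena.Ising3DConformalLimit.RotationUpgradeFromTwoPointNegative

end
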